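import Literature.NumberTheory.QuadraticFields.ThreeTorsionMeanProgressionTwist

/-!
# `EndJuntaRung` (stmt-QuantumAdvantage-2426) — characters of `2`-power modulus (algebraic lemmas)

Route `ArithStatLadder`, support item `EndJuntaRung`. Elementary algebra used to pass from
Taniguchi–Thorne's twisted 3-torsion sums (characters `χ (mod 2ʲ)` with `χ⁶ ≠ 1`) to classes
`a (mod 2ᵏ)`:

* `exists_odd_sq_sub_dvd_two_pow` — Hensel at `2`: an integer `u ≡ 1 (mod 8)` is an odd square
  modulo every `2ʲ`;
* `char_intCast_eq_one_of_sq_eq_one` — hence a character `χ (mod 2ʲ)` with `χ² = 1` is trivial on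
  the residues `≡ 1 (mod 8)`; `char_sq_eq_one_of_pow_six_eq_one` — and `χ⁶ = 1` forces `χ² = 1`
  (the character group `mod 2ʲ` is a `2`-group); so a character that is NOT trivial on the
  residues `≡ 1 (mod 8)` has `χ⁶ ≠ 1` (`char_pow_six_ne_one_of_apply_ne_one`);
* `char_intCast_eq_of_modEq_eight` — a character trivial on the residues `≡ 1 (mod 8)` only depends
  on the class `mod 8`;
* `sum_char_fiber_castHom_eq_zero` — a character not trivial on the residues `≡ 1 (mod 8)` sums to
  zero over every fibre of `ZMod 2ʲ → ZMod 8`;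
* `sum_filter_modEq_apply_eq_sum_char` — orthogonality of characters for a condition
  `f D ≡ a (mod m)` (the tree's `sum_filter_modEq_eq_sum_char` is the case `f = id`);
* `sum_filter_modEq_eq_sum_sum_filter_modEq` — a class `mod m` is the disjoint union of `q` classes
  `mod m q`.
-/

noncomputable section

set_option linter.dupNamespace false -- D-0017: single-problem summit ⇒ `QuantumAdvantage.QuantumAdvantage` by design

namespace Summit.QuantumAdvantage.QuantumAdvantage.Theorems.ArithStatLadder

open Finset
open Literature.NumberTheory.QuadraticFields

/-! ## Hensel at `2`: residues `≡ 1 (mod 8)` are squares modulo `2ʲ` -/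

/-- **Hensel's lemma at `2` for squares.** If `u ≡ 1 (mod 8)` then for every `j` there is an odd
`y` with `2ʲ ∣ y² − u` (lift `y ↦ y + 2ʲ⁻¹ t` from `2ʲ` to `2ʲ⁺¹`, `j ≥ 3`). -/
theorem exists_odd_sq_sub_dvd_two_pow {u : ℤ} (hu : u % 8 = 1) (j : ℕ) :
    ∃ y : ℤ, y % 2 = 1 ∧ (2:ℤ) ^ j ∣ y ^ 2 - u := by
  have base : ∀ i ≤ 3, ∃ y : ℤ, y % 2 = 1 ∧ (2:ℤ) ^ i ∣ y ^ 2 - u := by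
    intro i hi
    refine ⟨1, by norm_num, (pow_dvd_pow 2 hi).trans ?_⟩
    exact ⟨(1 - u) / 8, by omega⟩
  induction j with
  | zero => exact base 0 (by norm_num)
  | succ j ih =>
    by_cases hj : j + 1 ≤ 3
    · exact base _ hj
    obtain ⟨y, hy, t, ht⟩ := ih
    obtain ⟨w, hw⟩ : ∃ w : ℤ, y + 1 = 2 * w := ⟨(y + 1) / 2, by omega⟩
    set a : ℤ := 2 ^ (j - 1) with ha
    have hja : (2:ℤ) ^ j = 2 * a := by
      rw [ha, ← pow_succ']; congr 1; omega
    have hja' : (2:ℤ) ^ (j + 1) = 4 * a := by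
      rw [pow_succ, hja]; ring
    have hac : a = 4 * 2 ^ (j - 3) := by
      rw [ha, show (4:ℤ) = 2 ^ 2 by norm_num, ← pow_add]; congr 1; omega
    have h2a : (2:ℤ) ∣ a * t := by
      rw [hac, mul_assoc]; exact Dvd.dvd.mul_right (by norm_num) _
    refine ⟨y + a * t, ?_, t * w + 2 ^ (j - 3) * t ^ 2, ?_⟩
    · set e := a * t with he
      omega
    · rw [hja']
      rw [hja] at ht
      linear_combination ht + (2 * a * t) * hw + (a * t ^ 2) * hac

/-! ## Characters of `2`-power modulus -/

/-- An odd integer is a unit modulo `2ʲ`. -/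
theorem isUnit_intCast_zmod_two_pow_of_odd {y : ℤ} (hy : y % 2 = 1) (j : ℕ) :
    IsUnit ((y : ZMod (2 ^ j))) := by
  have h2 : IsCoprime (2:ℤ) y := by
    rw [Prime.coprime_iff_not_dvd Int.prime_two]
    omega
  have h : IsCoprime y ((2 ^ j : ℕ) : ℤ) := by
    push_cast
    exact h2.symm.pow_right
  exact isUnit_intCast_zmod_of_isCoprime h

/-- **A character `χ (mod 2ʲ)` with `χ² = 1` is trivial on the residues `≡ 1 (mod 8)`** (they are
squares of units, by Hensel). -/
theorem char_intCast_eq_one_of_sq_eq_one {j : ℕ} {χ : DirichletCharacter ℂ (2 ^ j)}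
    (hχ : χ ^ 2 = 1) {u : ℤ} (hu : u % 8 = 1) : χ ((u : ZMod (2 ^ j))) = 1 := by
  obtain ⟨y, hy, hdvd⟩ := exists_odd_sq_sub_dvd_two_pow hu j
  have hyu : ((u : ZMod (2 ^ j))) = (y : ZMod (2 ^ j)) ^ 2 := by
    rw [← Int.cast_pow, ZMod.intCast_eq_intCast_iff_dvd_sub]
    push_cast
    exact hdvd
  obtain ⟨v, hv⟩ := isUnit_intCast_zmod_two_pow_of_odd hy j
  rw [hyu, map_pow, ← hv, ← MulChar.pow_apply_coe, hχ, MulChar.one_apply_coe]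

/-- For a unit `x` of `ZMod 2ʲ`, `x ^ 2ʲ = 1` (`φ(2ʲ) ∣ 2ʲ`). -/
theorem units_zmod_two_pow_pow_eq_one (j : ℕ) (x : (ZMod (2 ^ j))ˣ) : x ^ 2 ^ j = 1 := by
  have hφ : Nat.totient (2 ^ j) ∣ 2 ^ j := by
    rcases j with _ | j
    · simp
    · rw [Nat.totient_prime_pow Nat.prime_two (Nat.succ_pos j)]
      simpa using pow_dvd_pow 2 (Nat.le_succ j)
  obtain ⟨c, hc⟩ := hφ
  have h := ZMod.pow_totient x
  calc x ^ 2 ^ j = (x ^ Nat.totient (2 ^ j)) ^ c := by rw [← pow_mul, ← hc]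
    _ = 1 := by rw [h, one_pow]

/-- A Dirichlet character `mod 2ʲ` satisfies `χ ^ 2ʲ = 1`. -/
theorem char_pow_two_pow_eq_one {j : ℕ} (χ : DirichletCharacter ℂ (2 ^ j)) : χ ^ 2 ^ j = 1 := by
  refine MulChar.ext fun x => ?_
  rw [MulChar.pow_apply_coe, ← map_pow, ← Units.val_pow_eq_pow_val,
    units_zmod_two_pow_pow_eq_one, Units.val_one, map_one, MulChar.one_apply_coe]

/-- **`χ⁶ = 1` forces `χ² = 1` for a character `mod 2ʲ`** (`gcd(6, 2ʲ) ∣ 2`). -/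
theorem char_sq_eq_one_of_pow_six_eq_one {j : ℕ} {χ : DirichletCharacter ℂ (2 ^ j)}
    (h6 : χ ^ 6 = 1) : χ ^ 2 = 1 := by
  have hg : χ ^ Nat.gcd 6 (2 ^ j) = 1 := pow_gcd_eq_one.mpr ⟨h6, char_pow_two_pow_eq_one χ⟩
  have hdvd : Nat.gcd 6 (2 ^ j) ∣ 2 := by
    have h3 : Nat.gcd (2 ^ j) 3 = 1 :=
      Nat.Coprime.pow_left j (by norm_num : Nat.Coprime 2 3)
    rw [Nat.gcd_comm, show (6:ℕ) = 3 * 2 by norm_num,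
      Nat.Coprime.gcd_mul (2 ^ j) (by norm_num : Nat.Coprime 3 2), h3, one_mul]
    exact Nat.gcd_dvd_right _ _
  obtain ⟨e, he⟩ := hdvd
  have h2 : χ ^ 2 = χ ^ (Nat.gcd 6 (2 ^ j) * e) := by rw [← he]
  rw [h2, pow_mul, hg, one_pow]

/-- A character `mod 2ʲ` that is not trivial on some residue `≡ 1 (mod 8)` has `χ⁶ ≠ 1`. -/
theorem char_pow_six_ne_one_of_apply_ne_one {j : ℕ} {χ : DirichletCharacter ℂ (2 ^ j)} {u : ℤ}
    (hu : u % 8 = 1) (hχu : χ ((u : ZMod (2 ^ j))) ≠ 1) : χ ^ 6 ≠ 1 := fun h6 =>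
  hχu (char_intCast_eq_one_of_sq_eq_one (char_sq_eq_one_of_pow_six_eq_one h6) hu)

/-- **A character trivial on the residues `≡ 1 (mod 8)` depends only on the class `mod 8`**: if
`χ(u) = 1` whenever `u ≡ 1 (mod 8)`, `8 ∣ 2ʲ`, `s` is odd and `x ≡ s (mod 8)`, then
`χ(x) = χ(s)` (`x ≡ s · (s' x)` with `s s' ≡ 1 (mod 2ʲ)` and `s' x ≡ 1 (mod 8)`). -/
theorem char_intCast_eq_of_modEq_eight {j : ℕ} {χ : DirichletCharacter ℂ (2 ^ j)}
    (hχ : ∀ u : ℤ, u % 8 = 1 → χ ((u : ZMod (2 ^ j))) = 1) (h8 : (8:ℤ) ∣ 2 ^ j) {x s : ℤ}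
    (hs : s % 2 = 1) (hxs : x ≡ s [ZMOD 8]) :
    χ ((x : ZMod (2 ^ j))) = χ ((s : ZMod (2 ^ j))) := by
  have hcop : IsCoprime s ((2:ℤ) ^ j) := by
    have h2 : IsCoprime (2:ℤ) s := by
      rw [Prime.coprime_iff_not_dvd Int.prime_two]; omega
    exact h2.symm.pow_right
  obtain ⟨s', t, hst⟩ := hcop
  -- `s s' ≡ 1 (mod 2ʲ)`, hence `(mod 8)`
  have h1 : s * s' ≡ 1 [ZMOD (2:ℤ) ^ j] := by
    rw [Int.modEq_iff_dvd]
    exact ⟨t, by linear_combination -1 * hst⟩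
  have h1' : s * s' ≡ 1 [ZMOD 8] := h1.of_dvd h8
  have hu : (x * s') % 8 = 1 := by
    have := (hxs.mul_right s').trans h1'
    exact this
  have hcast : ((x : ZMod (2 ^ j))) = ((x * s' : ℤ) : ZMod (2 ^ j)) * (s : ZMod (2 ^ j)) := by
    rw [← Int.cast_mul, ZMod.intCast_eq_intCast_iff]
    have : x * s' * s = x * (s * s') := by ring
    rw [this]
    have h := h1.mul_left x
    rw [mul_one] at h
    push_cast
    exact h.symm
  rw [hcast, map_mul, hχ _ hu, one_mul]

/-- **A character not trivial on the residues `≡ 1 (mod 8)` sums to zero over every fibre of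
`ZMod 2ʲ → ZMod 8`**: multiplication by a residue `y ≡ 1 (mod 8)` with `χ(y) ≠ 1` permutes the
fibre, so the sum `S` satisfies `S = χ(y) S`. -/
theorem sum_char_fiber_castHom_eq_zero {j : ℕ} (h8 : 8 ∣ 2 ^ j) (χ : DirichletCharacter ℂ (2 ^ j))
    {u : ℤ} (hu : u % 8 = 1) (hχu : χ ((u : ZMod (2 ^ j))) ≠ 1) (z : ZMod 8) :
    ∑ b ∈ (Finset.univ : Finset (ZMod (2 ^ j))).filter
        (fun b => ZMod.castHom h8 (ZMod 8) b = z), χ b = 0 := by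
  set ψ := ZMod.castHom h8 (ZMod 8) with hψ
  obtain ⟨y, hy⟩ := isUnit_intCast_zmod_two_pow_of_odd (show u % 2 = 1 by omega) j
  have hψy : ψ (y : ZMod (2 ^ j)) = 1 := by
    rw [hy, map_intCast, show (1 : ZMod 8) = ((1 : ℤ) : ZMod 8) by simp,
      ZMod.intCast_eq_intCast_iff]
    exact hu
  have hψy' : ψ ((y⁻¹ : (ZMod (2 ^ j))ˣ) : ZMod (2 ^ j)) = 1 := by
    have h := congrArg ψ (Units.inv_mul y)
    rwa [map_mul, hψy, mul_one, map_one] at h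
  set B := (Finset.univ : Finset (ZMod (2 ^ j))).filter (fun b => ψ b = z) with hB
  have hperm : ∑ b ∈ B, χ b = ∑ b ∈ B, χ ((y : ZMod (2 ^ j)) * b) := by
    refine Finset.sum_nbij' (fun b => ((y⁻¹ : (ZMod (2 ^ j))ˣ) : ZMod (2 ^ j)) * b)
      (fun b => (y : ZMod (2 ^ j)) * b) ?_ ?_ ?_ ?_ ?_
    · intro b hb
      simp only [hB, Finset.mem_filter, Finset.mem_univ, true_and] at hb ⊢
      rw [map_mul, hψy', one_mul, hb]
    · intro b hb
      simp only [hB, Finset.mem_filter, Finset.mem_univ, true_and] at hb ⊢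
      rw [map_mul, hψy, one_mul, hb]
    · intro b _
      rw [Units.mul_inv_cancel_left]
    · intro b _
      rw [Units.inv_mul_cancel_left]
    · intro b _
      rw [Units.mul_inv_cancel_left]
  have hmul : ∑ b ∈ B, χ ((y : ZMod (2 ^ j)) * b) = χ (y : ZMod (2 ^ j)) * ∑ b ∈ B, χ b := by
    rw [Finset.mul_sum]
    exact Finset.sum_congr rfl fun b _ => map_mul χ _ _
  rw [← hy] at hχu
  have h := hperm.trans hmul
  have h' : (1 - χ (y : ZMod (2 ^ j))) * ∑ b ∈ B, χ b = 0 := by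
    rw [sub_mul, one_mul, ← h, sub_self]
  rcases mul_eq_zero.mp h' with h0 | h0
  · exact absurd (sub_eq_zero.mp h0).symm hχu
  · exact h0

/-! ## Orthogonality for a condition `f D ≡ a (mod m)` -/

/-- **Orthogonality.** For `(a, m) = 1`, a finset `S` of integers, `f : ℤ → ℤ` and a weight
`w : ℤ → ℂ`: `Σ_{D ∈ S, f D ≡ a (mod m)} w(D) = φ(m)⁻¹ Σ_{χ (mod m)} χ(ā⁻¹) Σ_{D ∈ S} χ(f D) w(D)`
(the case `f = id` is the tree's `sum_filter_modEq_eq_sum_char`). -/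
theorem sum_filter_modEq_apply_eq_sum_char {m : ℕ} [NeZero m] {a : ℤ} (ha : IsCoprime a m)
    (S : Finset ℤ) (f : ℤ → ℤ) (w : ℤ → ℂ) :
    ∑ D ∈ S.filter (fun D => f D ≡ a [ZMOD m]), w D =
      (m.totient : ℂ)⁻¹ * ∑ χ : DirichletCharacter ℂ m,
        χ (a : ZMod m)⁻¹ * ∑ D ∈ S, χ ((f D : ℤ) : ZMod m) * w D := by
  classical
  have hu : IsUnit ((a : ZMod m)) := isUnit_intCast_zmod_of_isCoprime ha
  have hφ : (m.totient : ℂ) ≠ 0 := by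
    exact_mod_cast (Nat.totient_pos.2 (NeZero.pos m)).ne'
  have hswap : ∑ χ : DirichletCharacter ℂ m, χ (a : ZMod m)⁻¹ *
        ∑ D ∈ S, χ ((f D : ℤ) : ZMod m) * w D
      = ∑ D ∈ S, (∑ χ : DirichletCharacter ℂ m,
          χ (a : ZMod m)⁻¹ * χ ((f D : ℤ) : ZMod m)) * w D := by
    have : ∀ χ : DirichletCharacter ℂ m, χ (a : ZMod m)⁻¹ *
        ∑ D ∈ S, χ ((f D : ℤ) : ZMod m) * w D
        = ∑ D ∈ S, (χ (a : ZMod m)⁻¹ * χ ((f D : ℤ) : ZMod m)) * w D := fun χ => by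
      rw [Finset.mul_sum]
      simp_rw [mul_assoc]
    simp_rw [this]
    rw [Finset.sum_comm]
    simp_rw [← Finset.sum_mul]
  rw [hswap, Finset.mul_sum, Finset.sum_filter]
  refine Finset.sum_congr rfl fun D _ => ?_
  rw [DirichletCharacter.sum_char_inv_mul_char_eq ℂ hu]
  by_cases hD : f D ≡ a [ZMOD m]
  · have : (a : ZMod m) = ((f D : ℤ) : ZMod m) := (ZMod.intCast_eq_intCast_iff a (f D) m).2 hD.symm
    rw [if_pos this, if_pos hD, ← mul_assoc, inv_mul_cancel₀ hφ, one_mul]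
  · have : (a : ZMod m) ≠ ((f D : ℤ) : ZMod m) := fun h =>
      hD ((ZMod.intCast_eq_intCast_iff a (f D) m).1 h).symm
    rw [if_neg this, if_neg hD, zero_mul, mul_zero]

/-! ## A class `mod m` as a union of classes `mod m q` -/

/-- **Splitting a progression.** For `0 < m`, `0 < q`, a finset `S` of integers and a weight `w`
(in any additive commutative monoid):
`Σ_{D ∈ S, D ≡ a (m)} w(D) = Σ_{i < q} Σ_{D ∈ S, D ≡ a + m i (m q)} w(D)`. -/
theorem sum_filter_modEq_eq_sum_sum_filter_modEq {M : Type*} [AddCommMonoid M] {m q : ℕ}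
    (hm : 0 < m) (hq : 0 < q) (S : Finset ℤ) (a : ℤ) (w : ℤ → M) :
    ∑ D ∈ S.filter (fun D => D ≡ a [ZMOD m]), w D =
      ∑ i ∈ Finset.range q, ∑ D ∈ S.filter (fun D => D ≡ a + m * i [ZMOD ((m * q : ℕ) : ℤ)]), w D := by
  have hmq : (0:ℤ) < m * q := by positivity
  -- the index of the sub-class containing `D`
  have key : ∀ D : ℤ, D ≡ a [ZMOD m] →
      ∀ i ∈ Finset.range q, (D ≡ a + m * i [ZMOD ((m * q : ℕ) : ℤ)] ↔
        (i : ℤ) = (D - a) / m % q) := by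
    intro D hD i hi
    rw [Finset.mem_range] at hi
    obtain ⟨t, ht⟩ := (Int.modEq_iff_dvd.mp hD.symm)
    -- `D - a = m t`
    have hDa : (D - a) / m = t := by
      rw [ht]; exact Int.mul_ediv_cancel_left _ (by exact_mod_cast hm.ne')
    rw [hDa, Int.modEq_iff_dvd]
    push_cast
    constructor
    · rintro ⟨c, hc⟩
      -- `a + m i - D = m q c`, i.e. `m (i - t) = m q c`
      have h1 : (m:ℤ) * (i - t - q * c) = 0 := by linear_combination hc + ht
      have h2 : (i:ℤ) - t - q * c = 0 := by
        rcases mul_eq_zero.mp h1 with h | h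
        · exact absurd (by exact_mod_cast h) hm.ne'
        · exact h
      have h3 : (i:ℤ) = t + q * c := by linear_combination h2
      have h0 : (0:ℤ) ≤ t + q * c := by rw [← h3]; positivity
      have hlt : t + q * c < q := by rw [← h3]; exact_mod_cast hi
      rw [h3, show t % (q:ℤ) = (t + q * c) % q by rw [Int.add_mul_emod_self_left],
        Int.emod_eq_of_lt h0 hlt]
    · intro hi'
      refine ⟨-((t : ℤ) / q), ?_⟩
      have h4 : (t:ℤ) % q = t - q * (t / q) := by rw [Int.emod_def]
      rw [hi']
      linear_combination (m:ℤ) * h4 - ht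
  symm
  calc ∑ i ∈ Finset.range q, ∑ D ∈ S.filter (fun D => D ≡ a + m * i [ZMOD ((m * q : ℕ) : ℤ)]), w D
      = ∑ i ∈ Finset.range q, ∑ D ∈ S,
          (if D ≡ a + m * i [ZMOD ((m * q : ℕ) : ℤ)] then w D else 0) := by
        simp_rw [Finset.sum_filter]
    _ = ∑ D ∈ S, ∑ i ∈ Finset.range q,
          (if D ≡ a + m * i [ZMOD ((m * q : ℕ) : ℤ)] then w D else 0) := Finset.sum_comm
    _ = ∑ D ∈ S, (if D ≡ a [ZMOD m] then w D else 0) := by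
        refine Finset.sum_congr rfl fun D _ => ?_
        by_cases hD : D ≡ a [ZMOD m]
        · rw [if_pos hD]
          have hi0 : ((D - a) / m % q).toNat ∈ Finset.range q := by
            rw [Finset.mem_range]
            have := Int.emod_lt_of_pos ((D - a) / m) (show (0:ℤ) < q by exact_mod_cast hq)
            have := Int.emod_nonneg ((D - a) / m) (show (q:ℤ) ≠ 0 by exact_mod_cast hq.ne')
            omega
          rw [Finset.sum_eq_single_of_mem _ hi0]
          · rw [if_pos]
            rw [key D hD _ hi0]
            have := Int.emod_nonneg ((D - a) / m) (show (q:ℤ) ≠ 0 by exact_mod_cast hq.ne')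
            omega
          · intro i hi hne
            rw [if_neg]
            rw [key D hD i hi]
            intro h
            apply hne
            have := Int.emod_nonneg ((D - a) / m) (show (q:ℤ) ≠ 0 by exact_mod_cast hq.ne')
            omega
        · rw [if_neg hD]
          refine Finset.sum_eq_zero fun i _ => ?_
          rw [if_neg]
          intro h
          apply hD
          have h' := h.of_dvd (show (m:ℤ) ∣ ((m * q : ℕ) : ℤ) by push_cast; exact dvd_mul_right _ _)
          have : a + m * i ≡ a [ZMOD m] := by
            rw [Int.modEq_iff_dvd]; exact ⟨-(i:ℤ), by ring⟩
          exact h'.trans this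
    _ = ∑ D ∈ S.filter (fun D => D ≡ a [ZMOD m]), w D := by rw [Finset.sum_filter]

end Summit.QuantumAdvantage.QuantumAdvantage.Theorems.ArithStatLadder

end
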